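import Literature.NumberTheory.Automorphic.UnitaryGroupAdelicOrbitalMeasureCentral
import Literature.NumberTheory.Automorphic.UnitaryGroupPairOrbitalMeasureFamilyOfLocalAdelic
import HarnessLib

/-!
# Orbital integrals at CENTRAL elements against ANY measure: total mass times point value; the mass of
# `OrbitalMeasureFamily.ofLocalAdelicPair` at a class with central representative is a FINITE product of local masses
(Rogawski, *Automorphic representations of unitary groups in three variables* (1990), §5.4 pp. 72–73 (5.4.3); §14.5 Thm. 14.5.1 (a) p. 238: the stable
classes of `H = U(Φ₂) × U(Φ₁)` with scalar `U(Φ₂)`-component — `(a·1₂, b)`, `(ζ·1₂, ζ)` — have one-point local and adelic orbit spaces; Deitmar–Echterhoff,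
*Principles of Harmonic Analysis* (2014), Thm. 1.5.3)

Topic `NumberTheory/Automorphic`; namespaces `Literature.NumberTheory.Automorphic` (§1) and `….UnitaryGroup` (§2); THEOREMS ONLY (no definition, no
instance, no notation, no named fact, no `sorry`).  Sequel of ★ `UnitaryGroupAdelicOrbitalMeasureCentral` (there: the Dirac mass at a central class IS an
admissible orbital measure, `orbitalIntegral_dirac_of_forall_comm`); brick «H-c» (part 1 of 2) of sub-line O7 of the FLOOR-0 programme P3a (cell
hodgecm-mathlib): the generic half of the comparison kit's pins (xi-c) ∕ (xiii″-s) at the scalar classes; part 2 is ★-to-be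
`Rogawski1990/AdelicStableOrbitalCentralH` (the `H`-side carrier `𝒞′_𝐀(γ_H) = {[γ_H ⊗ 1]}` and `Φ^st_H(γ_H, f^H) = (mass) · f^H(γ_H ⊗ 1)`).
HC_CM is proved only modulo the printed citations until rung 0 closes.

## What is typed

* §1 GENERIC CENTRAL ELEMENT (any group `G`, `γ` with `∀ g, g γ = γ g`, ANY measure `μ` on `G ⧸ C(γ)`, ANY class-indexed family `m`): the orbital
  integrand `ȳ ↦ F(y γ y⁻¹)` is the constant `F γ`, so **`orbitalIntegral γ F μ = (μ univ).toReal • F γ`** (`orbitalIntegral_of_forall_comm`; and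
  `orbitalIntegral_const_fun` — a constant integrand needs no centrality); the class representative `out [γ]` IS `γ`
  (`quotientOut_conjClassesMk_eq_of_forall_comm`); **`classOrbitalIntegral m F [γ] = ((m [γ]) univ).toReal • F γ`** (`classOrbitalIntegral_mk_of_forall_comm`)
  and `= F γ` when that mass is `1` — the Dirac ∕ probability normalisation (`classOrbitalIntegral_mk_eq_apply_of_forall_comm`).  Junk-compatible:
  an infinite mass gives `0 = 0 • F γ`.
* §2 THE PAIR `H = U(H₂) × U(H₁)` over a CM field, ★ `OrbitalMeasureFamily.ofLocalAdelicPair mH mHi` at an adelic class `c` whose representative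
  `h = out c` is central in `H(𝔸)` with central local components `h_v` (admissibility ∕ normalisation binders VERBATIM as ★
  `classOrbitalIntegral_ofLocalAdelicPair_eval_eq_mul_prod`): off `S₀` the local one-point orbit spaces have mass `1` BY ★ `IsNormalisedOffPair`
  (`atPoint_pairToLocal_univ_eq_one_of_forall_comm`), and for EVERY test function `F`
  **`classOrbitalIntegral (ofLocalAdelicPair mH mHi) F c = (mHi.atPoint h_∞)(univ) · (∏_{v ∈ S₀} ((mH v).atPoint h_v)(univ)) · F h`**
  (`classOrbitalIntegral_ofLocalAdelicPair_of_forall_comm`) — the «product of local masses» is a finite product; via ★ `pairAdelicOrbitalMeasureOfLocal_spec`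
  (`F = 1 · 1` split), ★ `pairFinAdelicOrbitalMeasureOfLocal_spec` (`f_v ≡ 1`), integrability free (a one-point orbit space is compact).

## References
* J. D. Rogawski, *Automorphic Representations of Unitary Groups in Three Variables*, Ann. of Math. Stud. 123 (1990), §4.3 p. 44, §5.4 pp. 72–73,
  §14.5 p. 238 [Rogawski1990].
* A. Deitmar, S. Echterhoff, *Principles of Harmonic Analysis*, 2nd ed. (2014), Thm. 1.5.3 [DeitmarEchterhoff2014].
* S. Gelbart, *Automorphic forms on adele groups*, Ann. of Math. Stud. 83 (1975), (9.13), p. 155 (10.19) [Gelbart1975].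
-/

set_option autoImplicit false

noncomputable section

open MeasureTheory Measure Set Filter Topology NumberField IsDedekindDomain
open Literature.MeasureTheory.Group
open scoped ENNReal MatrixGroups

namespace Literature.NumberTheory.Automorphic

/-! ## §1 Orbital integrals at a central element against ANY measure: the total mass times the point value -/

section Central

variable {G : Type*} [Group G] {γ : G}

/-- The class representative `out [γ]` of a CENTRAL `γ` is `γ` itself (its conjugacy class is `{γ}`). [cite: DeitmarEchterhoff2014, Thm. 1.5.3] -/
theorem quotientOut_conjClassesMk_eq_of_forall_comm (hγ : ∀ g : G, g * γ = γ * g) :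
    (Quotient.out (ConjClasses.mk γ) : G) = γ := by
  have h0 : ConjClasses.mk (Quotient.out (ConjClasses.mk γ) : G) = ConjClasses.mk γ := Quotient.out_eq _
  obtain ⟨c, hc⟩ := isConj_iff.1 (ConjClasses.mk_eq_mk_iff_isConj.1 h0.symm)
  rw [← hc, hγ c, mul_inv_cancel_right]

variable [MeasurableSpace (G ⧸ Subgroup.centralizer ({γ} : Set G))]

/-- **The orbital integral of `F` at a CENTRAL `γ` against ANY measure `μ` on the (one-point) orbit space is `μ(univ) · F(γ)`**: the orbital
integrand `ȳ ↦ F(y γ y⁻¹)` is the constant `F γ` (`integral_const`; junk-compatible: an infinite mass gives `0 = 0 • F γ`).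
[cite: DeitmarEchterhoff2014, Thm. 1.5.3] -/
theorem orbitalIntegral_of_forall_comm {E : Type*} [NormedAddCommGroup E] [NormedSpace ℝ E] [CompleteSpace E]
    (hγ : ∀ g : G, g * γ = γ * g) (F : G → E) (μ : Measure (G ⧸ Subgroup.centralizer ({γ} : Set G))) :
    orbitalIntegral γ F μ = (μ Set.univ).toReal • F γ := by
  have hconst : descConj γ (Subgroup.centralizer ({γ} : Set G)) (fun _ hg => Subgroup.mem_centralizer_singleton_iff.1 hg) F = fun _ => F γ := by
    funext y
    induction y using QuotientGroup.induction_on with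
    | H g => rw [descConj_mk, hγ g, mul_inv_cancel_right]
  rw [orbitalIntegral_eq_integral_descConj, hconst, integral_const, Measure.real]

omit [Group G] in
/-- The orbital integral of a CONSTANT function at any `γ` against any measure `μ` is `μ(univ) · a` (no centrality needed).
[cite: DeitmarEchterhoff2014, Thm. 1.5.3] -/
theorem orbitalIntegral_const_fun [Group G] [MeasurableSpace (G ⧸ Subgroup.centralizer ({γ} : Set G))]
    {E : Type*} [NormedAddCommGroup E] [NormedSpace ℝ E] [CompleteSpace E] (a : E) (μ : Measure (G ⧸ Subgroup.centralizer ({γ} : Set G))) :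
    orbitalIntegral γ (fun _ => a) μ = (μ Set.univ).toReal • a := by
  have hconst : descConj γ (Subgroup.centralizer ({γ} : Set G)) (fun _ hg => Subgroup.mem_centralizer_singleton_iff.1 hg) (fun _ => a) = fun _ => a := by
    funext y
    induction y using QuotientGroup.induction_on with
    | H g => rw [descConj_mk]
  rw [orbitalIntegral_eq_integral_descConj, hconst, integral_const, Measure.real]

end Central

section CentralClass

variable {G : Type*} [Group G] {γ : G} [∀ g : G, MeasurableSpace (G ⧸ Subgroup.centralizer ({g} : Set G))]

/-- **The class orbital integral at the class of a CENTRAL `γ`, for ANY class-indexed family `m`, is `(m [γ])(univ) · F(γ)`.**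
[cite: DeitmarEchterhoff2014, Thm. 1.5.3] [cite: Gelbart1975, (9.13)] -/
theorem classOrbitalIntegral_mk_of_forall_comm {E : Type*} [NormedAddCommGroup E] [NormedSpace ℝ E] [CompleteSpace E]
    (hγ : ∀ g : G, g * γ = γ * g) (m : OrbitalMeasureFamily G) (F : G → E) :
    classOrbitalIntegral m F (ConjClasses.mk γ) = ((m (ConjClasses.mk γ)) Set.univ).toReal • F γ := by
  have hout := quotientOut_conjClassesMk_eq_of_forall_comm hγ
  have hγ' : ∀ g : G, g * (Quotient.out (ConjClasses.mk γ) : G) = (Quotient.out (ConjClasses.mk γ) : G) * g := by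
    rw [hout]; exact hγ
  rw [classOrbitalIntegral_eq, orbitalIntegral_of_forall_comm hγ' F (m (ConjClasses.mk γ))]
  exact congrArg (fun x => ((m (ConjClasses.mk γ)) Set.univ).toReal • F x) hout

/-- **Mass-one normalisation** (the Dirac mass of ★ `exists_smulInvariantMeasure_quotient_centralizer_of_forall_comm_top`, or any probability
measure, at the central class): the class orbital integral is the point value `F(γ)`. [cite: DeitmarEchterhoff2014, Thm. 1.5.3] -/
theorem classOrbitalIntegral_mk_eq_apply_of_forall_comm {E : Type*} [NormedAddCommGroup E] [NormedSpace ℝ E] [CompleteSpace E]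
    (hγ : ∀ g : G, g * γ = γ * g) (m : OrbitalMeasureFamily G) (F : G → E) (h1 : m (ConjClasses.mk γ) Set.univ = 1) :
    classOrbitalIntegral m F (ConjClasses.mk γ) = F γ := by
  rw [classOrbitalIntegral_mk_of_forall_comm hγ, h1, ENNReal.toReal_one, one_smul]

end CentralClass

namespace UnitaryGroup

/-! ## §2 The mass of `OrbitalMeasureFamily.ofLocalAdelicPair` at a class with CENTRAL representative: a finite product of local masses -/

section PairCentral

variable (L : Type) [Field L] [NumberField L] [IsCMField L] {N₂ N₁ : ℕ}
  (H₂ : Matrix (Fin N₂) (Fin N₂) L) (H₁ : Matrix (Fin N₁) (Fin N₁) L)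

variable
  [∀ (v : HeightOneSpectrum (𝓞 ↥(maximalRealSubfield L))) (x : pairLocal L H₂ H₁ v),
    MeasurableSpace (pairLocal L H₂ H₁ v ⧸ Subgroup.centralizer ({x} : Set (pairLocal L H₂ H₁ v)))]
  (mH : ∀ v : HeightOneSpectrum (𝓞 ↥(maximalRealSubfield L)), OrbitalMeasureFamily (pairLocal L H₂ H₁ v))
  (c : ConjClasses (pairAdelic L H₂ H₁))

/-- **Off the exceptional set the local one-point orbit spaces have mass `1`**: if `h_v = (out c)_v` is central in `H_v` and the local family is
normalised at `out c` off `S₀` (★ `IsNormalisedOffPair`), then `(mH v).atPoint h_v` is a probability measure for `v ∉ S₀` — the image of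
`U(H₂)(𝒪_v) × U(H₁)(𝒪_v)` in the one-point space `H_v ⧸ C(h_v)` is everything. [cite: Rogawski1990, §4.3 p. 44] -/
theorem atPoint_pairToLocal_univ_eq_one_of_forall_comm {S₀ : Finset (HeightOneSpectrum (𝓞 ↥(maximalRealSubfield L)))}
    (hcenv : ∀ (v : HeightOneSpectrum (𝓞 ↥(maximalRealSubfield L))) (g : pairLocal L H₂ H₁ v),
      g * pairToLocal L H₂ H₁ v (Quotient.out c : pairAdelic L H₂ H₁) = pairToLocal L H₂ H₁ v (Quotient.out c : pairAdelic L H₂ H₁) * g)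
    (hS₀ : IsNormalisedOffPair L H₂ H₁ mH (Quotient.out c : pairAdelic L H₂ H₁) S₀)
    (v : HeightOneSpectrum (𝓞 ↥(maximalRealSubfield L))) (hv : v ∉ S₀) :
    (mH v).atPoint (pairToLocal L H₂ H₁ v (Quotient.out c : pairAdelic L H₂ H₁)) Set.univ = 1 := by
  haveI := subsingleton_quotient_centralizer_of_forall_comm (hcenv v)
  have huniv : ((QuotientGroup.mk : pairLocal L H₂ H₁ v → pairLocal L H₂ H₁ v ⧸
        Subgroup.centralizer ({pairToLocal L H₂ H₁ v (Quotient.out c : pairAdelic L H₂ H₁)} : Set (pairLocal L H₂ H₁ v))) ''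
      ((cmLocalIntegralLevel L N₂ H₂ v : Set ((cmDatum L N₂ H₂).Local v)) ×ˢ
        (cmLocalIntegralLevel L N₁ H₁ v : Set ((cmDatum L N₁ H₁).Local v)))) = Set.univ :=
    Set.eq_univ_of_forall fun y => ⟨1, Set.mk_mem_prod (one_mem _) (one_mem _), Subsingleton.elim _ _⟩
  rw [← huniv]
  exact hS₀ v hv

variable
  [∀ h : pairAdelic L H₂ H₁, MeasurableSpace (pairAdelic L H₂ H₁ ⧸ Subgroup.centralizer ({h} : Set (pairAdelic L H₂ H₁)))]
  [∀ a : pairArch L H₂ H₁, MeasurableSpace (pairArch L H₂ H₁ ⧸ Subgroup.centralizer ({a} : Set (pairArch L H₂ H₁)))]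
  (mHi : OrbitalMeasureFamily (pairArch L H₂ H₁))
  [∀ (v : HeightOneSpectrum (𝓞 ↥(maximalRealSubfield L))) (x : pairLocal L H₂ H₁ v),
    BorelSpace (pairLocal L H₂ H₁ v ⧸ Subgroup.centralizer ({x} : Set (pairLocal L H₂ H₁ v)))]
  [∀ h : pairAdelic L H₂ H₁, BorelSpace (pairAdelic L H₂ H₁ ⧸ Subgroup.centralizer ({h} : Set (pairAdelic L H₂ H₁)))]
  [∀ a : pairArch L H₂ H₁, BorelSpace (pairArch L H₂ H₁ ⧸ Subgroup.centralizer ({a} : Set (pairArch L H₂ H₁)))]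

/-- **THE MASS OF `ofLocalAdelicPair` AT A CLASS WITH CENTRAL REPRESENTATIVE.**  At an adelic class `c` of `H(𝔸) = U(H₂)(𝔸) × U(H₁)(𝔸)` whose
representative `h = out c` is central in `H(𝔸)` with central local components `h_v` (the scalar classes `(a·1₂, b)`, `(ζ·1₂, ζ)` of
`U(Φ₂) × U(Φ₁)`), where the local families are admissible and normalised off `S₀` (binders VERBATIM as ★ `classOrbitalIntegral_ofLocalAdelicPair_eval_eq_mul_prod`),
for EVERY test function `F`:
`classOrbitalIntegral (ofLocalAdelicPair mH mHi) F c = (mHi.atPoint h_∞)(univ) · (∏_{v ∈ S₀} ((mH v).atPoint h_v)(univ)) · F(h)` — the orbital integrand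
is the constant `F h` (§1), the adelic mass splits `∞ × f` (★ `pairAdelicOrbitalMeasureOfLocal_spec` at `F = 1 · 1`), the finite-adelic mass is the
exact Euler product of the local masses (★ `pairFinAdelicOrbitalMeasureOfLocal_spec` at `f_v ≡ 1`), and those are `1` off `S₀`
(`atPoint_pairToLocal_univ_eq_one_of_forall_comm`). [cite: Rogawski1990, §5.4 (5.4.3) pp. 72–73; §14.5 p. 238] [cite: Gelbart1975, p. 155 (10.19)] -/
theorem classOrbitalIntegral_ofLocalAdelicPair_of_forall_comm {S₀ : Finset (HeightOneSpectrum (𝓞 ↥(maximalRealSubfield L)))}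
    (hcen : ∀ g : pairAdelic L H₂ H₁, g * (Quotient.out c : pairAdelic L H₂ H₁) = (Quotient.out c : pairAdelic L H₂ H₁) * g)
    (hcenv : ∀ (v : HeightOneSpectrum (𝓞 ↥(maximalRealSubfield L))) (g : pairLocal L H₂ H₁ v),
      g * pairToLocal L H₂ H₁ v (Quotient.out c : pairAdelic L H₂ H₁) = pairToLocal L H₂ H₁ v (Quotient.out c : pairAdelic L H₂ H₁) * g)
    (hS₀ : IsNormalisedOffPair L H₂ H₁ mH (Quotient.out c : pairAdelic L H₂ H₁) S₀)
    (hadm : ∀ v, mH v (ConjClasses.mk (pairToLocal L H₂ H₁ v (Quotient.out c : pairAdelic L H₂ H₁))) ≠ 0 ∧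
      SMulInvariantMeasure (pairLocal L H₂ H₁ v) _ (mH v (ConjClasses.mk (pairToLocal L H₂ H₁ v (Quotient.out c : pairAdelic L H₂ H₁)))) ∧
      IsFiniteMeasureOnCompacts (mH v (ConjClasses.mk (pairToLocal L H₂ H₁ v (Quotient.out c : pairAdelic L H₂ H₁)))))
    (hadmA : mHi (ConjClasses.mk (pairArchPart L H₂ H₁ (Quotient.out c : pairAdelic L H₂ H₁))) ≠ 0 ∧
      SMulInvariantMeasure (pairArch L H₂ H₁) _ (mHi (ConjClasses.mk (pairArchPart L H₂ H₁ (Quotient.out c : pairAdelic L H₂ H₁)))) ∧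
      IsFiniteMeasureOnCompacts (mHi (ConjClasses.mk (pairArchPart L H₂ H₁ (Quotient.out c : pairAdelic L H₂ H₁)))))
    (F : pairAdelic L H₂ H₁ → ℂ) :
    classOrbitalIntegral (OrbitalMeasureFamily.ofLocalAdelicPair L H₂ H₁ mH mHi) F c =
      ((mHi.atPoint (pairArchPart L H₂ H₁ (Quotient.out c : pairAdelic L H₂ H₁)) Set.univ).toReal : ℂ) *
        (∏ v ∈ S₀, (((mH v).atPoint (pairToLocal L H₂ H₁ v (Quotient.out c : pairAdelic L H₂ H₁)) Set.univ).toReal : ℂ)) *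
          F (Quotient.out c : pairAdelic L H₂ H₁) := by
  classical
  letI : MeasurableSpace (pairFinAdelic L H₂ H₁ ⧸
      Subgroup.centralizer ({pairFinPart L H₂ H₁ (Quotient.out c : pairAdelic L H₂ H₁)} : Set (pairFinAdelic L H₂ H₁))) := borel _
  haveI : BorelSpace (pairFinAdelic L H₂ H₁ ⧸
      Subgroup.centralizer ({pairFinPart L H₂ H₁ (Quotient.out c : pairAdelic L H₂ H₁)} : Set (pairFinAdelic L H₂ H₁))) := ⟨rfl⟩
  haveI : ∀ v, SMulInvariantMeasure (pairLocal L H₂ H₁ v) _ (mH v (ConjClasses.mk (pairToLocal L H₂ H₁ v (Quotient.out c : pairAdelic L H₂ H₁)))) := fun v => (hadm v).2.1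
  haveI : ∀ v, IsFiniteMeasureOnCompacts (mH v (ConjClasses.mk (pairToLocal L H₂ H₁ v (Quotient.out c : pairAdelic L H₂ H₁)))) := fun v => (hadm v).2.2
  haveI : ∀ v, SMulInvariantMeasure (pairLocal L H₂ H₁ v) _ ((mH v).atPoint (pairToLocal L H₂ H₁ v (Quotient.out c : pairAdelic L H₂ H₁))) :=
    fun v => (mH v).smulInvariantMeasure_atPoint _
  haveI : ∀ v, IsFiniteMeasureOnCompacts ((mH v).atPoint (pairToLocal L H₂ H₁ v (Quotient.out c : pairAdelic L H₂ H₁))) :=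
    fun v => (mH v).isFiniteMeasureOnCompacts_atPoint _
  haveI := hadmA.2.1
  haveI := hadmA.2.2
  haveI : SMulInvariantMeasure (pairArch L H₂ H₁) _ (mHi.atPoint (pairArchPart L H₂ H₁ (Quotient.out c : pairAdelic L H₂ H₁))) := mHi.smulInvariantMeasure_atPoint _
  haveI : IsFiniteMeasureOnCompacts (mHi.atPoint (pairArchPart L H₂ H₁ (Quotient.out c : pairAdelic L H₂ H₁))) := mHi.isFiniteMeasureOnCompacts_atPoint _
  haveI : SFinite (mHi.atPoint (pairArchPart L H₂ H₁ (Quotient.out c : pairAdelic L H₂ H₁))) := by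
    haveI : IsLocallyFiniteMeasure (mHi.atPoint (pairArchPart L H₂ H₁ (Quotient.out c : pairAdelic L H₂ H₁))) := isLocallyFiniteMeasure_of_isFiniteMeasureOnCompacts
    haveI : SigmaFinite (mHi.atPoint (pairArchPart L H₂ H₁ (Quotient.out c : pairAdelic L H₂ H₁))) := sigmaFinite_of_locallyFinite
    infer_instance
  have hne : ∀ v, (mH v).atPoint (pairToLocal L H₂ H₁ v (Quotient.out c : pairAdelic L H₂ H₁)) ≠ 0 := fun v => (mH v).atPoint_ne_zero _ (hadm v).1
  -- the finite part of the central representative is central (`finPart` is onto, componentwise)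
  have hcenf : ∀ g : pairFinAdelic L H₂ H₁,
      g * pairFinPart L H₂ H₁ (Quotient.out c : pairAdelic L H₂ H₁) = pairFinPart L H₂ H₁ (Quotient.out c : pairAdelic L H₂ H₁) * g := by
    intro g
    obtain ⟨x, rfl⟩ : ∃ x : pairAdelic L H₂ H₁, pairFinPart L H₂ H₁ x = g :=
      ⟨(Classical.choose (finPart_surjective (↥(maximalRealSubfield L)) L (IsCMField.complexConj L) N₂ H₂ g.1),
          Classical.choose (finPart_surjective (↥(maximalRealSubfield L)) L (IsCMField.complexConj L) N₁ H₁ g.2)),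
        Prod.ext (Classical.choose_spec (finPart_surjective (↥(maximalRealSubfield L)) L (IsCMField.complexConj L) N₂ H₂ g.1))
          (Classical.choose_spec (finPart_surjective (↥(maximalRealSubfield L)) L (IsCMField.complexConj L) N₁ H₁ g.2))⟩
    rw [← map_mul, ← map_mul, hcen x]
  -- the finite-adelic orbit space is one point, hence compact: the finite-adelic orbital measure is finite
  haveI hsub : Subsingleton (pairFinAdelic L H₂ H₁ ⧸
      Subgroup.centralizer ({pairFinPart L H₂ H₁ (Quotient.out c : pairAdelic L H₂ H₁)} : Set (pairFinAdelic L H₂ H₁))) :=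
    subsingleton_quotient_centralizer_of_forall_comm hcenf
  have hfinspec := pairFinAdelicOrbitalMeasureOfLocal_spec L H₂ H₁ (Quotient.out c : pairAdelic L H₂ H₁)
    (fun v => (mH v).atPoint (pairToLocal L H₂ H₁ v (Quotient.out c : pairAdelic L H₂ H₁))) hS₀ (fun v _ => hne v)
  haveI := hfinspec.2.1
  haveI : IsFiniteMeasure (pairFinAdelicOrbitalMeasureOfLocal L H₂ H₁ (Quotient.out c : pairAdelic L H₂ H₁)
      (fun v => (mH v).atPoint (pairToLocal L H₂ H₁ v (Quotient.out c : pairAdelic L H₂ H₁))) S₀) :=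
    CompactSpace.isFiniteMeasure
  -- integrality of `h_f` off a finite set
  obtain ⟨Sh, hSh⟩ := Literature.MeasureTheory.RestrictedProduct.exists_finset_forall_not_mem_apply_mem
    (fun v => pairLocalInt L H₂ H₁ v) (pairFinAdelicEquiv L H₂ H₁ (pairFinPart L H₂ H₁ (Quotient.out c : pairAdelic L H₂ H₁)))
  -- the orbital integrand of the constant `1` is the constant `1`, integrable on the finite orbit space
  have hInt : Integrable (descConj (pairFinPart L H₂ H₁ (Quotient.out c : pairAdelic L H₂ H₁))
      (Subgroup.centralizer ({pairFinPart L H₂ H₁ (Quotient.out c : pairAdelic L H₂ H₁)} : Set (pairFinAdelic L H₂ H₁)))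
      (centralizer_comm _) (fun _ => (1 : ℂ)))
      (pairFinAdelicOrbitalMeasureOfLocal L H₂ H₁ (Quotient.out c : pairAdelic L H₂ H₁)
        (fun v => (mH v).atPoint (pairToLocal L H₂ H₁ v (Quotient.out c : pairAdelic L H₂ H₁))) S₀) := by
    have hc1 : descConj (pairFinPart L H₂ H₁ (Quotient.out c : pairAdelic L H₂ H₁))
        (Subgroup.centralizer ({pairFinPart L H₂ H₁ (Quotient.out c : pairAdelic L H₂ H₁)} : Set (pairFinAdelic L H₂ H₁)))
        (centralizer_comm _) (fun _ => (1 : ℂ)) = fun _ => 1 := by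
      funext y
      induction y using QuotientGroup.induction_on with
      | H g => rw [descConj_mk]
    rw [hc1]
    exact integrable_const _
  -- the finite-adelic mass is the product over `S₀` of the local masses (all `1` off `S₀`)
  have hfin := (hfinspec.2.2.2.2 (fun _ _ => (1 : ℂ)) (fun _ => (1 : ℂ)) (S₀ ∪ Sh)
    (fun S _ b _ => Finset.prod_const_one.symm) (fun v hv => hSh v fun h' => hv (Finset.mem_union_right _ h'))
    Finset.subset_union_left hInt).2 S₀ (fun v hv => by
      rw [orbitalIntegral_const_fun, atPoint_pairToLocal_univ_eq_one_of_forall_comm L H₂ H₁ mH c hcenv hS₀ v hv, ENNReal.toReal_one, one_smul])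
  -- the adelic mass splits `∞ × f`
  have hsplit := (pairAdelicOrbitalMeasureOfLocal_spec L H₂ H₁ (Quotient.out c : pairAdelic L H₂ H₁)
    (mHi.atPoint (pairArchPart L H₂ H₁ (Quotient.out c : pairAdelic L H₂ H₁)))
    (fun v => (mH v).atPoint (pairToLocal L H₂ H₁ v (Quotient.out c : pairAdelic L H₂ H₁))) (mHi.atPoint_ne_zero _ hadmA.1) hS₀
    (fun v _ => hne v)).2.2.2 (fun _ => (1 : ℂ)) (fun _ => (1 : ℂ)) (fun _ => (1 : ℂ)) (fun _ => (one_mul (1 : ℂ)).symm)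
  rw [hfin, orbitalIntegral_const_fun, orbitalIntegral_const_fun, Complex.real_smul, Complex.real_smul, mul_one, mul_one] at hsplit
  simp only [orbitalIntegral_const_fun, Complex.real_smul, mul_one] at hsplit
  -- assemble
  have heq := OrbitalMeasureFamily.ofLocalAdelicPair_eq L H₂ H₁ mH mHi c hS₀ hadm
  change orbitalIntegral (Quotient.out c : pairAdelic L H₂ H₁) F (OrbitalMeasureFamily.ofLocalAdelicPair L H₂ H₁ mH mHi c) = _
  rw [heq, orbitalIntegral_of_forall_comm hcen F, Complex.real_smul, hsplit]

end PairCentral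

end UnitaryGroup

end Literature.NumberTheory.Automorphic
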